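import Summits.AtomisticToContinuum.HydrodynamicLimit.Theorems.CorrectorPressureDecay.Negative.Statics
import Summits.AtomisticToContinuum.HydrodynamicLimit.Theorems.CorrectorPressureDecay.Negative.MazurFloor
import Summits.AtomisticToContinuum.HydrodynamicLimit.Theorems.CorrectorPressureDecay.Negative.FreeFlow

/-!
# `CorrectorPressureDecay` — negative knowledge (a.3): collisions are load-bearing — the crux FAILS at `σ = 0`

Support file for crux `stmt-AtomisticToContinuum-14135` (`AntiMazurCoboundaries.CorrectorPressureDecay`, "X"),
written by the standing disprover (cdisprove seat, cycle 2). UNCONDITIONAL version of the cycle-1 finding (a.3),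
which was proved modulo `FreeFlowZeroDiameter ∧ ExponentialCertificate`: the free gas is now an honest inhabitant
of the crux's flow type at `σ = 0` (`FreeFlow.freeFlow₀`), and the certificate (hence the cost clause) is not needed
at all — the LD Mazur floor `integral_exp_le_integral_exp_sub_coboundary_of_invariant` applies directly: under the
free flight the one-body sum `F = Σᵢ g(vᵢ)` is INVARIANT, so for every lag and every bounded corrector `W` the defect
integral is at least the static one, `∫ e^{2(F − D_W)} dG_N ≥ ∫ e^{2F} dG_N = (E_γ e^{2g})^{N+1}`, which is
`e^{2δ(N+1)} > e^{δ(N+1)}` for the admissible witness `g = gW κ` and `δ = ½ log E_γ e^{2g} > 0`.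

* `CorrectorPressureDecayZeroDiameter` — the crux's inner statement with `σ := 0` substituted (a variant statement
  refuted below, not a fact);
* `correctorPressureDecay_false_zeroDiameter : ¬ CorrectorPressureDecayZeroDiameter`.

Reading for provers: any proof of X must use `σ > 0` through an actual collision mechanism — invariance of `G_N`,
orthogonality `g ⊥ 1, v, |v|²`, the amplitude clause and the corrector/cost structure are all satisfied verbatim by
the free gas, where X is false. (The planner's cheapest falsifier (i) / `IdealGasNoDecay`, as a theorem.)
-/

noncomputable section

open MeasureTheory ProbabilityTheory Set Filter Topology
open scoped ENNReal

namespace Summit.AtomisticToContinuum.HydrodynamicLimit.Theorems.CorrectorPressureDecayNegative.ZeroDiameter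

open Literature.MathematicalPhysics.KineticTheory (T3 V3 hsDiameter localGibbsLaw localGibbsMeasure
  localGibbsProfile localGibbsLaw_eq isProbabilityMeasure_localGibbsLaw)
open Literature.Analysis.FluidPDE (HardSphereFlow Config freeFlight freeFlight_apply)
open Summit.AtomisticToContinuum.HydrodynamicLimit.Theorems.CellForecastPressureDecay (gW continuous_gW abs_gW_le
  gW_orthogonal one_lt_integral_exp_gW)
open Statics (integrable_exp_mul_gW)

/-- Hard-sphere flows of `N + 1` spheres of reduced diameter `σ` on `𝕋³` (the crux's `Φ`). -/
abbrev Flow (σ : ℝ) (N : ℕ) : Type :=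
  HardSphereFlow (Literature.Analysis.FluidPDE.Torus.geometry (Fin 3)) (hsDiameter σ N) (N + 1)

/-- Phase space of `N + 1` spheres on `𝕋³`. -/
abbrev Phase (N : ℕ) : Type := Config (N + 1) (Fin 3) T3

/-- The crux's inner statement at reduced diameter `σ = 0` (the `∃σ₀ ∀σ<σ₀` prefix dropped and `σ := 0`
substituted; all other tokens verbatim; `hsDiameter 0 N = 0`: point particles). A variant statement refuted below,
not a fact. -/
def CorrectorPressureDecayZeroDiameter : Prop :=
  ∀ (a θ : ℝ) (u₀ : V3), 0 < a → 0 < θ →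
    (∀ (N : ℕ) (Φ : Flow 0 N),
      IsProbabilityMeasure (localGibbsLaw 0 (fun _ => a) (fun _ => u₀) (fun _ => θ) N Φ)) ∧
    ∃ κ : ℝ, 0 < κ ∧ ∀ (φ : T3 → ℝ) (g : V3 → ℝ), Continuous φ → Continuous g → (∀ x, |φ x| ≤ 1) →
      (∀ v, |g v| ≤ κ) →
      (∀ (c₀ c₂ : ℝ) (b : V3), ∫ v, g v * (c₀ + inner ℝ b v + c₂ * ‖v‖ ^ 2) ∂stdGaussian V3 = 0) →
      ∀ δ : ℝ, 0 < δ → ∃ τ₀ : ℝ, 0 < τ₀ ∧ ∃ N₀ : ℕ, ∀ N : ℕ, N₀ ≤ N → ∀ Φ : Flow 0 N,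
        ∃ lag : ℝ, 0 < lag ∧ ∃ W : Phase N → ℝ, Measurable W ∧ (∃ C : ℝ, ∀ z, |W z| ≤ C) ∧
          ∫⁻ z, ENNReal.ofReal (Real.exp (2 * ((∑ i, φ (z i).1 * g ((Real.sqrt θ)⁻¹ • ((z i).2 - u₀))) -
              lag⁻¹ * (W (Φ.flow lag z) - W z))))
            ∂(localGibbsLaw 0 (fun _ => a) (fun _ => u₀) (fun _ => θ) N Φ) ≤
            ENNReal.ofReal (Real.exp (δ * (N + 1))) ∧
          ∫⁻ z, ENNReal.ofReal (Real.exp (4 * (τ₀ * ((N + 1 : ℕ) : ℝ) ^ (-(1 / 3 : ℝ)))⁻¹ * |W z|))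
            ∂(localGibbsLaw 0 (fun _ => a) (fun _ => u₀) (fun _ => θ) N Φ) ≤
            ENNReal.ofReal (Real.exp (δ * (N + 1)))

/-- **Collisions are load-bearing: X is FALSE at `σ = 0`.** Witness `a = θ = 1`, `u₀ = 0`, `φ ≡ 1`, `g = gW κ`
(the prover's own `κ`), `δ = ½ log E_γ e^{2g} > 0`, `N = N₀`, `Φ = freeFlow₀ N₀` (free flight): `F = Σ g(vᵢ)` is
flow-invariant, so by the LD Mazur floor the defect is at least the static moment `(E_γ e^{2g})^{N+1} = e^{2δ(N+1)}`
for EVERY lag and corrector — the cost clause is not even used. [folklore] -/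
theorem correctorPressureDecay_false_zeroDiameter : ¬ CorrectorPressureDecayZeroDiameter := by
  intro h
  obtain ⟨hprob, κ, hκ, hmain⟩ := h 1 1 0 one_pos one_pos
  set M : ℝ := ∫ v, Real.exp (2 * gW κ v) ∂stdGaussian V3 with hM
  have hM1 : 1 < M := one_lt_integral_exp_gW hκ.ne'
  set δ : ℝ := Real.log M / 2 with hδ
  have hlogpos : 0 < Real.log M := Real.log_pos hM1
  have hδpos : 0 < δ := by positivity
  obtain ⟨τ₀, _hτ₀, N₀, hN⟩ := hmain (fun _ => 1) (gW κ) continuous_const (continuous_gW κ) (fun _ => by simp)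
    (abs_gW_le hκ.le) (gW_orthogonal κ) δ hδpos
  -- the free gas
  set Φ : Flow 0 N₀ := FreeFlow.freeFlow₀ N₀ with hΦ
  obtain ⟨lag, _hlag, W, hWm, ⟨CW, hW⟩, h1, _h2⟩ := hN N₀ le_rfl Φ
  haveI := hprob N₀ Φ
  set G := localGibbsLaw 0 (fun _ => (1 : ℝ)) (fun _ => (0 : V3)) (fun _ => (1 : ℝ)) N₀ Φ with hGdef
  -- the invariant observable `2F`
  set F : Phase N₀ → ℝ := fun z => ∑ i, 2 * gW κ (z i).2 with hF
  have hFm : Measurable F := by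
    have hc := continuous_gW κ
    have : Continuous F := by
      simp only [hF]
      fun_prop
    exact this.measurable
  have hFb : ∀ z, |F z| ≤ ∑ _i : Fin (N₀ + 1), 2 * κ := fun z =>
    (Finset.abs_sum_le_sum_abs _ _).trans (Finset.sum_le_sum fun i _ => by
      rw [abs_mul, abs_two]; exact mul_le_mul_of_nonneg_left (abs_gW_le hκ.le _) two_pos.le)
  have hFinv : ∀ z : Phase N₀, F (Φ.flow lag z) = F z := by
    intro z
    simp only [hF, hΦ, FreeFlow.freeFlow₀, FreeFlow.freeFlow_flow, freeFlight_apply]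
  have hinv : MeasurePreserving (Φ.flow lag) G G := measurePreserving_flow_localGibbsLaw 1 1 N₀ Φ lag
  -- rewrite the defect clause with `F`
  have hrw1 : ∀ z : Phase N₀, Real.exp (2 * ((∑ i, (fun _ : T3 => (1 : ℝ)) (z i).1 *
      gW κ ((Real.sqrt 1)⁻¹ • ((z i).2 - 0))) - lag⁻¹ * (W (Φ.flow lag z) - W z))) =
      Real.exp (F z - (2 * lag⁻¹) * (W (Φ.flow lag z) - W z)) := by
    intro z
    simp only [hF, Real.sqrt_one, inv_one, sub_zero, one_smul, one_mul]
    congr 1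
    rw [← Finset.mul_sum]
    ring
  simp_rw [hrw1] at h1
  -- the Mazur floor: `∫ e^F ≤ ∫ e^{F - D}`
  have hfloor := integral_exp_le_integral_exp_sub_coboundary_of_invariant hinv hFm hWm hFb hW hFinv (2 * lag⁻¹)
  -- convert the defect clause to a Bochner integral
  have hYb : ∀ z, |F z - 2 * lag⁻¹ * (W (Φ.flow lag z) - W z)| ≤ (∑ _i : Fin (N₀ + 1), 2 * κ) +
      |2 * lag⁻¹| * (CW + CW) := by
    intro z
    calc |F z - 2 * lag⁻¹ * (W (Φ.flow lag z) - W z)| ≤ |F z| + |2 * lag⁻¹ * (W (Φ.flow lag z) - W z)| :=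
          abs_sub _ _
      _ = |F z| + |2 * lag⁻¹| * |W (Φ.flow lag z) - W z| := by rw [abs_mul]
      _ ≤ _ := by
          gcongr
          · exact hFb z
          · exact (abs_sub _ _).trans (add_le_add (hW _) (hW _))
  have hYint : Integrable (fun z => Real.exp (F z - 2 * lag⁻¹ * (W (Φ.flow lag z) - W z))) G :=
    integrable_exp_of_abs_le (hFm.sub (measurable_const.mul ((hWm.comp (Φ.measurable_flow lag)).sub hWm))) hYb
  rw [← ofReal_integral_eq_lintegral_ofReal hYint (ae_of_all _ fun _ => (Real.exp_pos _).le)] at h1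
  -- the static value `∫ e^F dG = M^{N+1}`
  have hstat : ∫⁻ z, ENNReal.ofReal (Real.exp (F z)) ∂G = (ENNReal.ofReal M) ^ (N₀ + 1) := by
    simp only [hF]
    rw [hGdef, localGibbsLaw_eq, lintegral_exp_sum_vel_localGibbsMeasure one_pos one_pos 0 (by norm_num) N₀
      ((continuous_gW κ).measurable.const_mul 2), gaussMeasure_zero_one,
      ← ofReal_integral_eq_lintegral_ofReal (integrable_exp_mul_gW 2 κ) (ae_of_all _ fun _ => (Real.exp_pos _).le)]
  have hFint : Integrable (fun z => Real.exp (F z)) G := integrable_exp_of_abs_le hFm hFb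
  have hstat' : ENNReal.ofReal (∫ z, Real.exp (F z) ∂G) = (ENNReal.ofReal M) ^ (N₀ + 1) := by
    rw [ofReal_integral_eq_lintegral_ofReal hFint (ae_of_all _ fun _ => (Real.exp_pos _).le), hstat]
  -- chain: M^{N+1} = ∫ e^F ≤ ∫ e^{F-D} ≤ e^{δ(N+1)}
  have hchain : (ENNReal.ofReal M) ^ (N₀ + 1) ≤ ENNReal.ofReal (Real.exp (δ * (N₀ + 1))) := by
    rw [← hstat']
    exact (ENNReal.ofReal_le_ofReal hfloor).trans h1
  have hfl : Real.exp (2 * δ) = M := by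
    rw [show 2 * δ = Real.log M by rw [hδ]; ring, Real.exp_log (by linarith)]
  rw [← hfl, ← ENNReal.ofReal_pow (Real.exp_pos _).le, ← Real.exp_nat_mul,
    ENNReal.ofReal_le_ofReal_iff (Real.exp_pos _).le, Real.exp_le_exp] at hchain
  push_cast at hchain
  nlinarith

end Summit.AtomisticToContinuum.HydrodynamicLimit.Theorems.CorrectorPressureDecayNegative.ZeroDiameter

end
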